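import Summits.BirchSwinnertonDyer.BirchSwinnertonDyer.Theses.LeadingTerm
import Literature.NumberTheory.EllipticCurves.BSDSelmerPConverseRankOneRubinProofs
import Literature.Barriers.BirchSwinnertonDyer.PAdicFunctionalEquationParityAnyPrimeProofs
import Summits.BirchSwinnertonDyer.BirchSwinnertonDyer.Theorems.PinchPrime.Negative.ConsequencesOfCrux

/-!
# BirchSwinnertonDyer / LeadingTerm — crux `PinchPrime` (stmt-BirchSwinnertonDyer-16218),
# line `SketchIdeator2`, stub `stub_analyticRank_eq_one_of_rank_eq_one_of_pinchPrime` (GLUE G16,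
# v29): NECESSITY at theorem grade — the crux contains the RANK-ONE CONVERSE (no Selmer hypothesis)

Registered stub of the lead skeleton `Cruxes/PinchPrime/Lines/SketchIdeator2.lean` (v29, lead c8),
the theorem-grade observation §0 of the crux-strategist census s2
(`Cruxes/PinchPrime/STRATEGY-CENSUS.md`, 2026-08-17): modulo PUBLISHED theorems entering as named-fact
hypotheses, the crux `LeadingTerm.PinchPrime` forces

    ∀ W, rank_ℤ W(ℚ) = 1 → ord_{s=1} L(W, s) = 1

for EVERY globally minimal elliptic `W/ℚ` — the rank-one converse to Gross–Zagier–Kolyvagin with NO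
`p^∞`-Selmer-corank and NO `Ш`-finiteness hypothesis (open in print: every known converse, Skinner
2014 / Burungale–Skinner–Tian–Wan 2024 / Kim 2022, starts from `corank Sel_{p^∞} = 1`). Together with
the refuter's landed rank-zero window
(`Theorems/PinchPrime/Negative/ConsequencesOfCrux.rank_eq_zero_iff_analyticRank_eq_zero_of_pinchPrime`)
this gives `analyticRank_eq_rank_of_rank_le_one_of_pinchPrime`: the crux CONTAINS BSD-rank on the
stratum `{rank ≤ 1}` (a majority of all `E/ℚ` by Bhargava–Shankar, conjecturally density one), and
with Gross–Zagier–Kolyvagin (`rank_eq_analyticRank_of_analyticRank_le_one`, a conjunct of the line's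
facts stub) BSD-rank on `{rank ≤ 1} ∪ {r_an ≤ 1}` (`rank_eq_analyticRank_of_pinchPrime_of_le_one`).

The chain, at the pinch prime `p ≥ 5` (good ordinary) of a rank-one `W` with newform `f`
(`ord_{T=0} L_p(f, α_p, T) = 1`), every step a tree THEOREM relative to the named facts:
1. Carayol (`hlev`): the level of `f` is `N_W`, so the conductor-level parity window applies:
   `ord_T L_p = 1` is odd ⇒ `ord_{s=1} L(W,s)` odd
   (`Literature.Barriers.BirchSwinnertonDyer.odd_analyticRank_of_order_padicLFunction_eq_one_conductorLevel_anyPrime`,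
   Greenberg LNM 1716 §5) ⇒ `w(W) = -1` (`even_analyticRank_iff_of_isNewformOf_conductorLevel`, Hecke).
2. Hoffstein–Luo (`hHL`) + modularity (`hmod`): an imaginary quadratic `K` with `d_K` odd, every
   `ℓ ∣ N_W` split, `p` split and `L(W^{(d_K)}, 1) ≠ 0`
   (`exists_heegnerField_odd_split_twist_ne_zero_of_hoffsteinLuo`).
3. Perrin-Riou's `p`-adic Gross–Zagier (`hPR`), Gross–Zagier (`hGZ`), Heegner points (`hHeeg`),
   modularity: `ord_T L_p(f) = 1 ⇒ ord_{s=1} L(W, s) = 1`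
   (`Literature.NumberTheory.EllipticCurves.analyticRank_eq_one_of_order_padicLFunction_eq_one`,
   Greenberg LNM 1716 §4 p. 111 read backwards).
No Kato, no main conjecture, no irreducibility, no Bertrand: the `p`-adic analytic rank one at ONE
good ordinary prime already pins the complex analytic rank.
-/

noncomputable section

set_option linter.dupNamespace false

namespace Summit.BirchSwinnertonDyer.BirchSwinnertonDyer.Cruxes.PinchPrime.FirstLayerStability

open scoped MatrixGroups ModularForm
open CongruenceSubgroup NumberField Literature.NumberTheory.EllipticCurves
  Literature.NumberTheory.EllipticCurves.ModularForms Literature.Barriers.BirchSwinnertonDyer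
open Summit.BirchSwinnertonDyer.BirchSwinnertonDyer.Theses

/-- **Pointwise form.** At a curve of Mordell–Weil rank `1`, a good ordinary prime `p ≥ 5` and a
newform `f` of `W` (any level; Carayol `hlev` moves it to `N_W`): if `ord_{T=0} L_p(f, α_p, T) =
rank_ℤ W(ℚ)` (the `(W, p, f)`-instance of the crux) then `ord_{s=1} L(W, s) = 1` — below
Perrin-Riou's `p`-adic Gross–Zagier formula, Gross–Zagier, Heegner points, modularity,
Hoffstein–Luo and Carayol (all named facts, published theorems).
[cite: PerrinRiou1987, Thm. 1.3 and §1.4] [cite: GreenbergLNM1716, §4 p. 111 and §5 p. 181]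
[cite: HoffsteinLuo1997, Theorem (§1, pp. 435–436)] -/
theorem analyticRank_eq_one_of_pinchAt_of_rank_eq_one
    (hPR : perrinRiou_padicGrossZagier)
    (hGZ : ∀ (N : ℕ) [NeZero N] (W : WeierstrassCurve ℚ) (K : Type) [Field K] [NumberField K],
      gross_zagier N W K)
    (hHeeg : ∀ (W : WeierstrassCurve ℚ) (K : Type) [Field K] [NumberField K],
      exists_isHeegnerPoint W K)
    (hmod : exists_isNewformOf) (hHL : HoffsteinLuo1997_exists_twist_L_one_ne_zero)
    (hlev : ∀ {N : ℕ} [NeZero N], IsNewformOf.level_eq_conductorNorm (N := N))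
    (W : WeierstrassCurve ℚ) [W.IsElliptic] [W.IsGloballyMinimal] (h1 : W.mordellWeilRank = 1)
    (p : ℕ) [Fact p.Prime] (h5 : 5 ≤ p) (hord : IsOrdinaryAt W p)
    {N : ℕ} [NeZero N] {f : CuspForm (Gamma0 N) 2} (hf : IsNewformOf W f)
    (horder : (padicLFunction f (unitRoot W p : ℚ_[p])).order = W.mordellWeilRank) :
    W.analyticRank = 1 := by
  obtain rfl : N = W.conductorNorm ℤ := hlev hf
  rw [h1, Nat.cast_one] at horder
  -- (1) parity at the conductor level: `ord_T L_p = 1` odd ⇒ `r_an` odd ⇒ `w(W) = -1`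
  have hodd : Odd W.analyticRank :=
    odd_analyticRank_of_order_padicLFunction_eq_one_conductorLevel_anyPrime hord hf horder
  have hw : W.rootNumber = -1 := by
    rcases W.rootNumber_eq_one_or with h | h
    · exact absurd ((even_analyticRank_iff_of_isNewformOf_conductorLevel hf).mpr h)
        (Nat.not_even_iff_odd.mpr hodd)
    · exact h
  -- (2) the auxiliary field of Perrin-Riou's theorem (Hoffstein–Luo)
  obtain ⟨K, _, _, hK, hoddK, hH, hsplit, hL1⟩ :=
    exists_heegnerField_odd_split_twist_ne_zero_of_hoffsteinLuo hmod hHL W hw p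
  -- (3) Perrin-Riou + Gross–Zagier
  exact analyticRank_eq_one_of_order_padicLFunction_eq_one hPR hGZ hHeeg hmod W p h5 hord.1 hord.2
    K hK hoddK hH hsplit hL1 hf horder

/-- STUB G16 (GLUE, NECESSITY at theorem grade — the rank-one converse inside the crux). Below
Perrin-Riou's `p`-adic Gross–Zagier formula (`perrinRiou_padicGrossZagier`), Gross–Zagier
(`gross_zagier`), the `K`-rationality of Heegner points (`exists_isHeegnerPoint`), modularity
(`exists_isNewformOf`), Hoffstein–Luo (`HoffsteinLuo1997_exists_twist_L_one_ne_zero`) and Carayol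
(`IsNewformOf.level_eq_conductorNorm`) — six PUBLISHED theorems as named-fact hypotheses — the crux
`LeadingTerm.PinchPrime` implies: every globally minimal elliptic `W/ℚ` of Mordell–Weil rank `1`
has analytic rank `1`. [cite: PerrinRiou1987, Thm. 1.3 and §1.4]
[cite: GreenbergLNM1716, §4 p. 111 and §5 p. 181] [cite: HoffsteinLuo1997, Theorem (§1, pp. 435–436)] -/
theorem stub_analyticRank_eq_one_of_rank_eq_one_of_pinchPrime :
    perrinRiou_padicGrossZagier →
    (∀ (N : ℕ) [NeZero N] (W : WeierstrassCurve ℚ) (K : Type) [Field K] [NumberField K],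
      gross_zagier N W K) →
    (∀ (W : WeierstrassCurve ℚ) (K : Type) [Field K] [NumberField K],
      exists_isHeegnerPoint W K) →
    exists_isNewformOf → HoffsteinLuo1997_exists_twist_L_one_ne_zero →
    (∀ {N : ℕ} [NeZero N], IsNewformOf.level_eq_conductorNorm (N := N)) →
    LeadingTerm.PinchPrime →
    ∀ (W : WeierstrassCurve ℚ) [W.IsElliptic] [W.IsGloballyMinimal],
      W.mordellWeilRank = 1 → W.analyticRank = 1 := by
  intro hPR hGZ hHeeg hmod hHL hlev hS W _ _ h1
  obtain ⟨p, hp, h5, hord, _D, _hD, N, hN, f, hf, horder⟩ := hS W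
  exact analyticRank_eq_one_of_pinchAt_of_rank_eq_one hPR hGZ hHeeg hmod hHL hlev W h1 p h5 hord hf
    horder

/-- **The crux contains BSD-rank on `{rank ≤ 1}`.** Below the six named facts of G16, the crux
implies `ord_{s=1} L(W, s) = rank_ℤ W(ℚ)` for every globally minimal elliptic `W/ℚ` of Mordell–Weil
rank `≤ 1`: rank `0` by the level-zero window at the pinch prime
(the refuter's landed `Theorems.PinchPrime.Negative.rank_eq_zero_iff_analyticRank_eq_zero_of_pinchPrime`,
Mazur–Tate–Teitelbaum interpolation + Hasse — unconditional), rank `1` by G16. [cite: MazurTateTeitelbaum1986Invent, §I.14 (14.3)]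
[cite: PerrinRiou1987, Thm. 1.3 and §1.4] -/
theorem analyticRank_eq_rank_of_rank_le_one_of_pinchPrime
    (hPR : perrinRiou_padicGrossZagier)
    (hGZ : ∀ (N : ℕ) [NeZero N] (W : WeierstrassCurve ℚ) (K : Type) [Field K] [NumberField K],
      gross_zagier N W K)
    (hHeeg : ∀ (W : WeierstrassCurve ℚ) (K : Type) [Field K] [NumberField K],
      exists_isHeegnerPoint W K)
    (hmod : exists_isNewformOf) (hHL : HoffsteinLuo1997_exists_twist_L_one_ne_zero)
    (hlev : ∀ {N : ℕ} [NeZero N], IsNewformOf.level_eq_conductorNorm (N := N))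
    (hS : LeadingTerm.PinchPrime)
    (W : WeierstrassCurve ℚ) [W.IsElliptic] [W.IsGloballyMinimal] (hle : W.mordellWeilRank ≤ 1) :
    W.analyticRank = W.mordellWeilRank := by
  rcases Nat.le_one_iff_eq_zero_or_eq_one.mp hle with h0 | h1
  · rw [h0]
    exact (Theorems.PinchPrime.Negative.rank_eq_zero_iff_analyticRank_eq_zero_of_pinchPrime hS W).mp h0
  · rw [h1]
    exact stub_analyticRank_eq_one_of_rank_eq_one_of_pinchPrime hPR hGZ hHeeg hmod hHL hlev hS W h1

/-- **The crux ∧ Gross–Zagier–Kolyvagin give BSD-rank on `{rank ≤ 1} ∪ {r_an ≤ 1}`.** Adding the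
line's facts-stub conjunct `rank_eq_analyticRank_of_analyticRank_le_one` (Gross–Zagier 1986,
Kolyvagin 1990: `r_an ≤ 1 ⇒ rank = r_an`), the crux implies `rank_ℤ W(ℚ) = ord_{s=1} L(W, s)` for
every globally minimal elliptic `W/ℚ` with `rank ≤ 1` OR `r_an ≤ 1` — i.e. off the doubly-higher
stratum `{rank ≥ 2 ∧ r_an ≥ 2}`, where the crux is the same-prime pair `#Ш[p^∞] < ∞ ∧ Reg_p ≠ 0`
instead (landed content theorem). [cite: Darmon2004, Thm. 3.22] [cite: PerrinRiou1987, Thm. 1.3 and §1.4] -/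
theorem rank_eq_analyticRank_of_pinchPrime_of_le_one
    (hPR : perrinRiou_padicGrossZagier)
    (hGZ : ∀ (N : ℕ) [NeZero N] (W : WeierstrassCurve ℚ) (K : Type) [Field K] [NumberField K],
      gross_zagier N W K)
    (hHeeg : ∀ (W : WeierstrassCurve ℚ) (K : Type) [Field K] [NumberField K],
      exists_isHeegnerPoint W K)
    (hmod : exists_isNewformOf) (hHL : HoffsteinLuo1997_exists_twist_L_one_ne_zero)
    (hlev : ∀ {N : ℕ} [NeZero N], IsNewformOf.level_eq_conductorNorm (N := N))
    (hGZK : rank_eq_analyticRank_of_analyticRank_le_one)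
    (hS : LeadingTerm.PinchPrime)
    (W : WeierstrassCurve ℚ) [W.IsElliptic] [W.IsGloballyMinimal]
    (hle : W.mordellWeilRank ≤ 1 ∨ W.analyticRank ≤ 1) :
    W.mordellWeilRank = W.analyticRank := by
  rcases hle with hle | hle
  · exact (analyticRank_eq_rank_of_rank_le_one_of_pinchPrime hPR hGZ hHeeg hmod hHL hlev hS W hle).symm
  · exact (hGZK W hle).1

end Summit.BirchSwinnertonDyer.BirchSwinnertonDyer.Cruxes.PinchPrime.FirstLayerStability

end
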